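import Summits.QuantumFields.BalabanUV.T4Continuum.Support.NE7MeanZeroGaugeSliceW
import Summits.QuantumFields.BalabanUV.T4Continuum.Support.NE7CornerSpikeTopDictionary
import Summits.QuantumFields.BalabanUV.T4Continuum.Support.NE3SmoothLiftW
import HarnessLib

/-!
# NE7EnergySliceFullGaugeSplit — THE LINEAR SLICE THEOREM FOR THE CORNER-FREE ENERGY SLICE OVER THE FULL GAUGE GROUP: every TANGENT direction `X` (`dirIter L (j+1) W X = 0`) splits as
# `X = X_E + gaugeDir W ζ` with `X_E ∈ 𝒯_E(W) = energyBlockLandauW` and a periodic skew gauge FUNCTION `ζ = η − spikeW M (M^d • framePotW X)` (`η ∈ Ξ_Q(W)` mean-zero with corners free,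
# the spike carrying the accumulated frames) — the linearisation of the nonlinear slice theorem (S1) of memo ROAD-G99 §3.9 ∕ (S1′)(i): NO FRAME OBSTRUCTION

Cell `pub-balaban`, rung (B)+1 sub-cell t4, lineage `b2b-balaban-t4-ne7-p1`, generation 99 (CRUX PROVER NE7 #1 = OWNER of BINDER row NE7).  Over gen 99's `NE7MeanZeroGaugeSliceW`
(`exists_decomposition_of_QbarIter_eq_zero`: the split inside `ker Q̄` by `Ξ_Q`), lit∕tree identities `NE7BalabanGaugeTransport.QbarIter_eq_neg_frame_of_tangent` (on the tangent space the
straight average is minus the coarse pure gauge of the accumulated frames), `NE7CornerSpikeTopDictionary.QbarIter_gaugeDir_spikeW` (the straight average of a top-corner spike gauge direction is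
the coarse pure gauge of `M^{−d}`·heights), `NE3CovariantLineSumsTower.QbarIter_add`, `NE3SmoothLiftW.framePotW_skew` ∕ `framePotW_add_period` — all BY NAME.
THE POINT (memo §3.9 (S1′)(i)).  The supplier of the Bałaban-slice road must regauge a representative into `𝒯_E(U_s) ⊆ ker Q̄`; a tangent `X` is NOT in `ker Q̄` (its straight average is
`−gaugeDir_V(framePotW X)`), and `Ξ_Q`-gauges do not change `Q̄`.  The missing freedom is the CORNER data of the gauge function: the spike `spikeW M (M^d • framePotW X)` has straight average
`+gaugeDir_V(framePotW X)` (`QbarIter_gaugeDir_spikeW`), so `X + gaugeDir W (spike)` IS in `ker Q̄` and the `Ξ_Q`-split applies.  Hence the linearised slice problem over ALL periodic gauge functions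
is solvable (and uniquely so modulo covariant constants, `NE7MeanZeroGaugeSliceW`); the «frame matching» of the supplier is this same step, not an extra condition.
WHAT ([folklore]; 0 def, 0 sorry).  `spike_mem` (skewness∕periodicity of the frame spike), **`add_spike_mem_ker_QbarIter`** (`X` tangent ⟹ `Q̄(X + gaugeDir W (spikeW M (M^d•framePotW X))) = 0`),
**`exists_fullGauge_split_of_tangent`** (`X` tangent ⟹ `∃ ζ` skew `(tower)`-periodic, `∃ X_E ∈ energyBlockLandauW L N (j+1) W`, `X = X_E + gaugeDir W ζ` pointwise).
HONEST FRAMING (page 1): exact linear kinematics in the multi-level small-field class; the NONLINEAR slice theorem (iteration, sup control through the letter) is NOT here; NOT the supplier, NOT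
NE7; spine 0∕9; finite T⁴ rung (B)+1 — NOT infinite volume, NOT mass gap, NOT BetaPertH, NOT Clay.  Continuum YM on T⁴ ⇐ BetaPertH ∧ nine spine estimates (0/9 proved); BetaPertH ⇐ (D1) ∧ (D4)
∧ CAP+tail; G-an2-4 gates asym, D1 and NE2/3/4.
-/

set_option autoImplicit false

open scoped BigOperators Matrix.Norms.L2Operator

namespace Summit.QuantumFields.BalabanUV.T4Continuum.NE7EnergySliceFullGaugeSplit

open Literature.MathematicalPhysics.QuantumFieldTheory.Balaban1983to89
open B7Prop1Explicit B7Prop2Explicit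
open T4AveragingDeficitWall (IsUnitaryCfg IsSkewDir SmallField)
open T4AveragingDeficitWallBoundary (IsPeriodicCfg)
open AveragingDeficitPeriodicCounting (IsPeriodicDir)
open AveragingDeficitMultiLevelPrep (cavgIter LevelSmall tower)
open BlockAveragePushDirGauge (gaugeDir isPeriodicDir_gaugeDir)
open NE3TangentCovariantTower (QbarIter framePotW dirIter)
open NE3CornerSpikes (spikeW spikeW_mem_skewAdjoint spikeW_add_period)
open NE3LandauOrbit (gaugeDir_skew)
open NE3TangentCovariantStructure (gaugeDir_add_fun)
open NE3SmoothLiftW (framePotW_skew framePotW_add_period)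
open NE3CovariantLineSumsTower (QbarIter_add)
open NE7CornerSpikeTopDictionary (QbarIter_gaugeDir_spikeW gaugeDir_smul_fun natCast_tower_eq_pow_mul)
open NE7BalabanGaugeTransport (QbarIter_eq_neg_frame_of_tangent)
open NE7MeanZeroGaugeSliceW (energyBlockLandauW meanZeroGaugeSpaceW mem_meanZeroGaugeSpaceW_iff exists_decomposition_of_QbarIter_eq_zero)

noncomputable section

variable {d : ℕ} {n : Type*} [Fintype n] [DecidableEq n]

/-- The frame spike `spikeW M (M^d • framePotW X)` of a skew `(tower)`-periodic direction is a skew `(tower)`-periodic gauge function (`M = L^{j+1}`). [folklore] -/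
theorem spike_mem [Nonempty n] {L N : ℕ} [NeZero N] (hL : 1 ≤ L) (j : ℕ)
    {W : Site d → Fin d → (Matrix n n ℂ)ˣ} {x : ℝ} (hWu : IsUnitaryCfg W) (hWP : IsPeriodicCfg W ((tower L N (j + 1) : ℕ) : ℤ))
    (hx : 0 ≤ x) (hs : LevelSmall d L j x) (hWx : SmallField W x)
    {X : Site d → Fin d → Matrix n n ℂ} (hX : IsSkewDir X) (hXP : IsPeriodicDir X ((tower L N (j + 1) : ℕ) : ℤ)) :
    (∀ y, spikeW (L ^ (j + 1)) (fun z => ((L : ℝ) ^ d) ^ (j + 1) • framePotW L (j + 1) W X z) y ∈ skewAdjoint (Matrix n n ℂ)) ∧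
    (∀ (y : Site d) (i : Fin d), spikeW (L ^ (j + 1)) (fun z => ((L : ℝ) ^ d) ^ (j + 1) • framePotW L (j + 1) W X z) (y + ((tower L N (j + 1) : ℕ) : ℤ) • e i)
      = spikeW (L ^ (j + 1)) (fun z => ((L : ℝ) ^ d) ^ (j + 1) • framePotW L (j + 1) W X z) y) := by
  have hM : 1 ≤ L ^ (j + 1) := Nat.one_le_pow _ L (by omega)
  have hh : ∀ z, ((L : ℝ) ^ d) ^ (j + 1) • framePotW L (j + 1) W X z ∈ skewAdjoint (Matrix n n ℂ) :=
    fun z => skewAdjoint.smul_mem _ (framePotW_skew hL j hWu hx hs hWx hX z)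
  have hhP : ∀ (z : Site d) (τ : Fin d), ((L : ℝ) ^ d) ^ (j + 1) • framePotW L (j + 1) W X (z + (N : ℤ) • e τ) = ((L : ℝ) ^ d) ^ (j + 1) • framePotW L (j + 1) W X z :=
    fun z τ => by rw [framePotW_add_period L j hWP hXP z τ]
  refine ⟨fun y => spikeW_mem_skewAdjoint _ hh y, fun y i => ?_⟩
  rw [natCast_tower_eq_pow_mul]
  exact spikeW_add_period hM hhP y i

/-- **THE FRAME SPIKE PUTS A TANGENT DIRECTION INTO `ker Q̄`**: in the multi-level small-field class at `W`, for `X` skew `(tower)`-periodic with `dirIter L (j+1) W X = 0`,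
`QbarIter L (j+1) W (X + gaugeDir W (spikeW M (M^d • framePotW X))) = 0` (`M = L^{j+1}`). [folklore] -/
theorem add_spike_mem_ker_QbarIter [Nonempty n] {L N : ℕ} [NeZero N] (hL : 1 ≤ L) (j : ℕ)
    {W : Site d → Fin d → (Matrix n n ℂ)ˣ} {x : ℝ} (hWu : IsUnitaryCfg W) (hWP : IsPeriodicCfg W ((tower L N (j + 1) : ℕ) : ℤ))
    (hx : 0 ≤ x) (hs : LevelSmall d L j x) (hWx : SmallField W x)
    {X : Site d → Fin d → Matrix n n ℂ} (hX : IsSkewDir X) (hXP : IsPeriodicDir X ((tower L N (j + 1) : ℕ) : ℤ)) (hXT : dirIter L (j + 1) W X = 0) :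
    QbarIter L (j + 1) W (fun y μ => X y μ + gaugeDir W (spikeW (L ^ (j + 1)) (fun z => ((L : ℝ) ^ d) ^ (j + 1) • framePotW L (j + 1) W X z)) y μ) = 0 := by
  have hh : ∀ z, ((L : ℝ) ^ d) ^ (j + 1) • framePotW L (j + 1) W X z ∈ skewAdjoint (Matrix n n ℂ) :=
    fun z => skewAdjoint.smul_mem _ (framePotW_skew hL j hWu hx hs hWx hX z)
  have hhP : ∀ (z : Site d) (τ : Fin d), ((L : ℝ) ^ d) ^ (j + 1) • framePotW L (j + 1) W X (z + (N : ℤ) • e τ) = ((L : ℝ) ^ d) ^ (j + 1) • framePotW L (j + 1) W X z :=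
    fun z τ => by rw [framePotW_add_period L j hWP hXP z τ]
  have hL0 : (0 : ℝ) < (L : ℝ) ^ d := pow_pos (by exact_mod_cast (show 0 < L by omega)) d
  have hc : (((L : ℝ) ^ d)⁻¹) ^ (j + 1) * ((L : ℝ) ^ d) ^ (j + 1) = 1 := by
    rw [← mul_pow, inv_mul_cancel₀ hL0.ne', one_pow]
  rw [QbarIter_add hL j hWu hx hs hWx]
  funext z κ
  rw [QbarIter_gaugeDir_spikeW hL j hWu hWP hx hs hWx hh hhP z κ]
  have e1 : (fun y => (((L : ℝ) ^ d)⁻¹) ^ (j + 1) • (((L : ℝ) ^ d) ^ (j + 1) • framePotW L (j + 1) W X y)) = framePotW L (j + 1) W X := by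
    funext y; rw [smul_smul, hc, one_smul]
  rw [e1, QbarIter_eq_neg_frame_of_tangent hL j hWu hWP hx hs hWx hX hXP hXT]
  show -gaugeDir (cavgIter L (j + 1) W) (framePotW L (j + 1) W X) z κ + gaugeDir (cavgIter L (j + 1) W) (framePotW L (j + 1) W X) z κ = (0 : Site d → Fin d → Matrix n n ℂ) z κ
  rw [neg_add_cancel]; rfl

/-- **THE LINEAR SLICE THEOREM FOR `𝒯_E` OVER THE FULL GAUGE GROUP**: in the multi-level small-field class at `W` (unitary, `(tower L N (j+1))`-periodic, `SmallField W x`, `LevelSmall d L j x`,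
`0 ≤ x`, `L ≥ 1`), every skew `(tower)`-periodic TANGENT direction `X` (`dirIter L (j+1) W X = 0`) is `X = X_E + gaugeDir W ζ` with `X_E ∈ energyBlockLandauW L N (j+1) W` and `ζ` a skew
`(tower)`-periodic gauge FUNCTION (namely `ζ = η − spikeW M (M^d • framePotW X)`, `η ∈ Ξ_Q(W)`). [folklore] -/
theorem exists_fullGauge_split_of_tangent [Nonempty n] {L N : ℕ} [NeZero N] (hL : 1 ≤ L) (j : ℕ)
    {W : Site d → Fin d → (Matrix n n ℂ)ˣ} {x : ℝ} (hWu : IsUnitaryCfg W) (hWP : IsPeriodicCfg W ((tower L N (j + 1) : ℕ) : ℤ))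
    (hx : 0 ≤ x) (hs : LevelSmall d L j x) (hWx : SmallField W x)
    {X : Site d → Fin d → Matrix n n ℂ} (hX : IsSkewDir X) (hXP : IsPeriodicDir X ((tower L N (j + 1) : ℕ) : ℤ)) (hXT : dirIter L (j + 1) W X = 0) :
    ∃ (ζ : Site d → Matrix n n ℂ) (XE : Site d → Fin d → Matrix n n ℂ),
      (∀ y, ζ y ∈ skewAdjoint (Matrix n n ℂ)) ∧ (∀ (y : Site d) (i : Fin d), ζ (y + ((tower L N (j + 1) : ℕ) : ℤ) • e i) = ζ y) ∧
      XE ∈ energyBlockLandauW (d := d) (n := n) L N (j + 1) W ∧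
      ∀ y μ, X y μ = XE y μ + gaugeDir W ζ y μ := by
  obtain ⟨hσs, hσP⟩ := spike_mem hL j hWu hWP hx hs hWx hX hXP
  set σ := spikeW (L ^ (j + 1)) (fun z => ((L : ℝ) ^ d) ^ (j + 1) • framePotW L (j + 1) W X z) with hσ
  -- `Y := X + gaugeDir W σ ∈ ker Q̄`, skew, periodic
  have hYs : IsSkewDir (fun y μ => X y μ + gaugeDir W σ y μ) :=
    fun y μ => (skewAdjoint _).add_mem (hX y μ) (gaugeDir_skew hWu hσs y μ)
  have hYP : IsPeriodicDir (fun y μ => X y μ + gaugeDir W σ y μ) ((tower L N (j + 1) : ℕ) : ℤ) := by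
    intro y i μ
    have h1 := hXP y i μ
    have h2 := isPeriodicDir_gaugeDir hWP hσP y i μ
    simp only [h1, h2]
  have hYQ := add_spike_mem_ker_QbarIter hL j hWu hWP hx hs hWx hX hXP hXT
  obtain ⟨η, hη, hE⟩ := exists_decomposition_of_QbarIter_eq_zero hL j hWu hWP hx hs hWx hYs hYP hYQ
  obtain ⟨⟨hηP, hηs⟩, -⟩ := mem_meanZeroGaugeSpaceW_iff.mp hη
  refine ⟨fun y => -(σ y + η y), _, fun y => (skewAdjoint _).neg_mem ((skewAdjoint _).add_mem (hσs y) (hηs y)), fun y i => ?_, hE, fun y μ => ?_⟩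
  · simp only [hσP y i, hηP y i]
  · -- `X = (X + gaugeDir σ + gaugeDir η) + gaugeDir (−(σ + η))`
    have hneg : gaugeDir W (fun y => -(σ y + η y)) y μ = -(gaugeDir W σ y μ + gaugeDir W η y μ) := by
      have e : (fun y => -(σ y + η y)) = fun y => (-1 : ℝ) • (σ y + η y) := funext fun y => by rw [neg_one_smul]
      rw [e, gaugeDir_smul_fun, gaugeDir_add_fun, neg_one_smul]
    rw [hneg]
    abel

end

end Summit.QuantumFields.BalabanUV.T4Continuum.NE7EnergySliceFullGaugeSplit
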